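import Literature.MathematicalPhysics.QuantumLattice.DysonTwoTimeGibbsWord
import Literature.MathematicalPhysics.QuantumLattice.ShiftedHubbardDysonDeterminant
import HarnessLib

/-!
# The two-time (unequal imaginary time) perturbation series of the Hubbard two-point function with shifted densities —
# operator level

Topic `MathematicalPhysics/QuantumLattice`; the two-time companion of `ShiftedHubbardTwoPointDeterminant` (equal-time two-point function
with the Hartree / chemical-potential counterterm `ν`) and the model-level corollary of `DysonTwoTimeGibbsWord`
(`Matrix.hasSum_dyson_trace_gibbs_twoTime_sum`).  For the Hubbard model with SHIFTED densities
`H = dΓ(h_μ) + U Σ_z (n_{z↑} − ν₀)(n_{z↓} − ν₁)` on a finite graph and `0 ≤ s ≤ β`: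

* `hasSum_dyson_trace_twoTime_shiftedQuartic` — generic shifted quartic family: `Tr(e^{−(β−s)(H₀+gV)} X e^{−s(H₀+gV)} Y)` is the
  entire series `Σ_N g^N Σ_{k+j=N} ∫_{Δ_k(1−s/β)}∫_{Δ_j(s/β)} (−β)^N Σ_{f,f′} (∏v)(∏v′) Tr(e^{−βH₀} · Y · ∏_i Ṽ_{f i}(s_i) · X(s_X) ·
  ∏_l Ṽ_{f′ l}(s_X + s′_l))`, `Ṽ = (a⁺a⁻ − ν₁)(a⁺a⁻ − ν₂)` the evolved shifted vertices, `s_i = −βu_i`, `s_X = −(β−s)`, `s′_l = −βu′_l`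
  (conjugation by `e^{sH₀}` is multiplicative and fixes the shifts);
* **`hasSum_shiftedHubbard_twoPoint_twoTime_trace`** — the Hubbard model on any finite graph, observables `X = c†_{xσ}` (time `−(β−s)`) and
  `Y = c_{yσ′}` (time `0`): the series for `Tr(e^{−(β−s)H} c†_{xσ} e^{−sH} c_{yσ′})`;
* **`hasSum_hubbard_twoPoint_twoTime_renormalised_trace`** — equal real shifts `ν`: the same series sums to
  `e^{−βUν²|Λ|} · Tr(e^{−(β−s)(H(t,U) − (μ+Uν)N)} c†_{xσ} e^{−s(H(t,U) − (μ+Uν)N)} c_{yσ′})` (free Fermi surface at `μ`, interacting model at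
  `μ + Uν`) — the two-time analogue of `hasSum_hubbard_twoPoint_renormalised_det` BEFORE the Wick step.

The free expectations in the coefficients are those of the word `c_{yσ′}(0) · ∏_{i<k} Ṽ_{x_i}(s_i) · c†_{xσ}(−(β−s)) · ∏_{l<j} Ṽ_{x′_l}(−(β−s)+s′_l)`
(a SPLIT external pair around the first vertex block); their determinant form (interleaved shifted Wick theorem) is NOT taken here.
Everything is PROVED; no definition.

## References
* G. Benfatto, A. Giuliani, V. Mastropietro, Ann. Henri Poincaré 7 (2006) 809–898, §1.2 (1.2)–(1.4), §2.1 (2.8) (the perturbation series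
  of the Schwinger functions at unequal times, with the counterterm `ν`). [BenfattoGiulianiMastropietro2006]
* O. Bratteli, D. W. Robinson, *Operator Algebras and Quantum Statistical Mechanics II*, 2nd ed. (1997), §5.4.1. [BratteliRobinsonII1997]
-/

noncomputable section

namespace Literature.MathematicalPhysics.QuantumLattice

open NormedSpace Matrix Finset Finset.Nat
open scoped ComplexOrder

/-! ### The two-time Dyson series of a shifted quartic perturbation -/

section ShiftedQuartic

variable {ι : Type*} [LinearOrder ι] [Fintype ι]

/-- **Two-time Dyson series for a SHIFTED quartic perturbation** `V = Σ_r v_r (c†_{p₁r}c_{q₁r} − ν₁r)(c†_{p₂r}c_{q₂r} − ν₂r)` and observables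
`X, Y`: for `0 < β`, `0 ≤ s ≤ β`,
`Tr(e^{−(β−s)(H₀+gV)} X e^{−s(H₀+gV)} Y) = Σ_N g^N Σ_{k+j=N} ∫_{Δ_k(1−s/β)} ∫_{Δ_j(s/β)} (−β)^N Σ_{f,f′} (∏v)(∏v′) ·
  Tr(e^{−βH₀} · Y · ∏_i Ṽ_{f i}(−βu_i) · X(−(β−s)) · ∏_l Ṽ_{f′ l}(−(β−s)−βu′_l))`, the evolved shifted vertices
`Ṽ_r(τ) = (a⁺_{p₁r}(τ)a⁻_{q₁r}(τ) − ν₁r)(a⁺_{p₂r}(τ)a⁻_{q₂r}(τ) − ν₂r)`. [cite: BenfattoGiulianiMastropietro2006, §2.1 (2.8)] -/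
theorem hasSum_dyson_trace_twoTime_shiftedQuartic {R : Type*} [Fintype R] {β : ℝ} (hβ : 0 < β) (h : Matrix ι ι ℂ)
    (X Y : Matrix (Finset ι) (Finset ι) ℂ) (v : R → ℂ) (p₁ q₁ p₂ q₂ : R → ι) (ν₁ ν₂ : R → ℂ) (g : ℂ) {s : ℝ} (hs0 : 0 ≤ s)
    (hsβ : s ≤ β) :
    HasSum (fun N : ℕ => g ^ N * ∑ kj ∈ antidiagonal N,
        orderedIntegral kj.1 (fun u : Fin kj.1 → ℝ =>
          orderedIntegral kj.2 (fun u' : Fin kj.2 → ℝ =>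
            (-(β : ℂ)) ^ (kj.1 + kj.2) * ∑ f : Fin kj.1 → R, ∑ f' : Fin kj.2 → R, ((∏ i, v (f i)) * ∏ l, v (f' l)) *
              (Matrix.gibbsWeight β (dGamma h) * (Y *
                ((List.ofFn fun i : Fin kj.1 =>
                    ((exp ((((u i : ℝ) : ℂ) * -(β : ℂ)) • dGamma h) * creation (p₁ (f i)) *
                          exp (-((((u i : ℝ) : ℂ) * -(β : ℂ)) • dGamma h))) *
                        (exp ((((u i : ℝ) : ℂ) * -(β : ℂ)) • dGamma h) * annihilation (q₁ (f i)) *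
                          exp (-((((u i : ℝ) : ℂ) * -(β : ℂ)) • dGamma h))) -
                      ν₁ (f i) • (1 : Matrix (Finset ι) (Finset ι) ℂ)) *
                    ((exp ((((u i : ℝ) : ℂ) * -(β : ℂ)) • dGamma h) * creation (p₂ (f i)) *
                          exp (-((((u i : ℝ) : ℂ) * -(β : ℂ)) • dGamma h))) *
                        (exp ((((u i : ℝ) : ℂ) * -(β : ℂ)) • dGamma h) * annihilation (q₂ (f i)) *
                          exp (-((((u i : ℝ) : ℂ) * -(β : ℂ)) • dGamma h))) -
                      ν₂ (f i) • (1 : Matrix (Finset ι) (Finset ι) ℂ))).prod *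
                  (exp (((((β - s) / β : ℝ) : ℂ) * -(β : ℂ)) • dGamma h) * X *
                    exp (-(((((β - s) / β : ℝ) : ℂ) * -(β : ℂ)) • dGamma h))) *
                  (List.ofFn fun l : Fin kj.2 =>
                    ((exp ((((((β - s) / β + u' l : ℝ) : ℂ)) * -(β : ℂ)) • dGamma h) * creation (p₁ (f' l)) *
                          exp (-((((((β - s) / β + u' l : ℝ) : ℂ)) * -(β : ℂ)) • dGamma h))) *
                        (exp ((((((β - s) / β + u' l : ℝ) : ℂ)) * -(β : ℂ)) • dGamma h) * annihilation (q₁ (f' l)) *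
                          exp (-((((((β - s) / β + u' l : ℝ) : ℂ)) * -(β : ℂ)) • dGamma h))) -
                      ν₁ (f' l) • (1 : Matrix (Finset ι) (Finset ι) ℂ)) *
                    ((exp ((((((β - s) / β + u' l : ℝ) : ℂ)) * -(β : ℂ)) • dGamma h) * creation (p₂ (f' l)) *
                          exp (-((((((β - s) / β + u' l : ℝ) : ℂ)) * -(β : ℂ)) • dGamma h))) *
                        (exp ((((((β - s) / β + u' l : ℝ) : ℂ)) * -(β : ℂ)) • dGamma h) * annihilation (q₂ (f' l)) *
                          exp (-((((((β - s) / β + u' l : ℝ) : ℂ)) * -(β : ℂ)) • dGamma h))) -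
                      ν₂ (f' l) • (1 : Matrix (Finset ι) (Finset ι) ℂ))).prod))).trace)
            (s / β)) ((β - s) / β))
      ((Matrix.gibbsWeight (β - s) (dGamma h + g • ∑ r, v r •
          ((creation (p₁ r) * annihilation (q₁ r) - ν₁ r • 1) * (creation (p₂ r) * annihilation (q₂ r) - ν₂ r • 1))) * X *
        (Matrix.gibbsWeight s (dGamma h + g • ∑ r, v r •
          ((creation (p₁ r) * annihilation (q₁ r) - ν₁ r • 1) * (creation (p₂ r) * annihilation (q₂ r) - ν₂ r • 1))) * Y)).trace) := by
  have hs := Matrix.hasSum_dyson_trace_gibbs_twoTime_sum hβ (dGamma h) X Y v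
    (fun r => (creation (p₁ r) * annihilation (q₁ r) - ν₁ r • 1) * (creation (p₂ r) * annihilation (q₂ r) - ν₂ r • 1)) g hs0 hsβ
  simp only [exp_mul_mul_mul_exp_neg, exp_mul_sub_smul_one_mul_exp_neg] at hs
  set Hf := dGamma h + g • ∑ r, v r •
    ((creation (p₁ r) * annihilation (q₁ r) - ν₁ r • 1) * (creation (p₂ r) * annihilation (q₂ r) - ν₂ r • 1)) with hHf
  have hW1 : exp (-((((β - s : ℝ) : ℂ)) • Hf)) = Matrix.gibbsWeight (β - s) Hf := by rw [Matrix.gibbsWeight, neg_smul]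
  have hW2 : exp (-((s : ℂ) • Hf)) = Matrix.gibbsWeight s Hf := by rw [Matrix.gibbsWeight, neg_smul]
  rw [hW1, hW2] at hs
  exact hs

end ShiftedQuartic

/-! ### The Hubbard model: the two-point function at unequal imaginary times -/

section ShiftedHubbard

variable {Λ : Type*} [LinearOrder Λ] [Fintype Λ] (G : SimpleGraph Λ) [DecidableRel G.Adj]

/-- **The shifted two-time perturbation series of the Hubbard two-point function, operator level.**  On any finite graph, for real
`β > 0`, `t, U, μ`, complex shifts `ν₀, ν₁`, orbitals `(x,σ), (y,σ′)` and `0 ≤ s ≤ β`, with `h = hubbardOneBody G t μ`: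
`Tr(e^{−(β−s)H} c†_{xσ} e^{−sH} c_{yσ′})`, `H = dΓ(h) + U Σ_z (n_{z↑} − ν₀)(n_{z↓} − ν₁)`, equals the entire series
`Σ_N U^N Σ_{k+j=N} ∫_{Δ_k(1−s/β)}∫_{Δ_j(s/β)} (−β)^N Σ_{x⃗,x⃗′} Tr(e^{−βdΓ(h)} · c_{yσ′} · ∏_i Ṽ_{x_i}(−βu_i) · c†_{xσ}(−(β−s)) · ∏_l Ṽ_{x′_l}(−(β−s)−βu′_l))`.
[cite: BenfattoGiulianiMastropietro2006, §2.1 (2.8)] -/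
theorem hasSum_shiftedHubbard_twoPoint_twoTime_trace {β : ℝ} (hβ : 0 < β) (t U μ : ℝ) (ν : Fin 2 → ℂ) (x y : Λ) (σ σ' : Fin 2)
    {s : ℝ} (hs0 : 0 ≤ s) (hsβ : s ≤ β) :
    HasSum (fun N : ℕ => (U : ℂ) ^ N * ∑ kj ∈ antidiagonal N,
        orderedIntegral kj.1 (fun u : Fin kj.1 → ℝ =>
          orderedIntegral kj.2 (fun u' : Fin kj.2 → ℝ =>
            (-(β : ℂ)) ^ (kj.1 + kj.2) * ∑ f : Fin kj.1 → Λ, ∑ f' : Fin kj.2 → Λ,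
              (Matrix.gibbsWeight β (dGamma (hubbardOneBody G t μ)) * (annihilation (orb y σ') *
                ((List.ofFn fun i : Fin kj.1 =>
                    ((exp ((((u i : ℝ) : ℂ) * -(β : ℂ)) • dGamma (hubbardOneBody G t μ)) * creation (orb (f i) 0) *
                          exp (-((((u i : ℝ) : ℂ) * -(β : ℂ)) • dGamma (hubbardOneBody G t μ)))) *
                        (exp ((((u i : ℝ) : ℂ) * -(β : ℂ)) • dGamma (hubbardOneBody G t μ)) * annihilation (orb (f i) 0) *
                          exp (-((((u i : ℝ) : ℂ) * -(β : ℂ)) • dGamma (hubbardOneBody G t μ)))) -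
                      ν 0 • (1 : Matrix (Finset (Orb Λ)) (Finset (Orb Λ)) ℂ)) *
                    ((exp ((((u i : ℝ) : ℂ) * -(β : ℂ)) • dGamma (hubbardOneBody G t μ)) * creation (orb (f i) 1) *
                          exp (-((((u i : ℝ) : ℂ) * -(β : ℂ)) • dGamma (hubbardOneBody G t μ)))) *
                        (exp ((((u i : ℝ) : ℂ) * -(β : ℂ)) • dGamma (hubbardOneBody G t μ)) * annihilation (orb (f i) 1) *
                          exp (-((((u i : ℝ) : ℂ) * -(β : ℂ)) • dGamma (hubbardOneBody G t μ)))) -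
                      ν 1 • (1 : Matrix (Finset (Orb Λ)) (Finset (Orb Λ)) ℂ))).prod *
                  (exp (((((β - s) / β : ℝ) : ℂ) * -(β : ℂ)) • dGamma (hubbardOneBody G t μ)) * creation (orb x σ) *
                    exp (-(((((β - s) / β : ℝ) : ℂ) * -(β : ℂ)) • dGamma (hubbardOneBody G t μ)))) *
                  (List.ofFn fun l : Fin kj.2 =>
                    ((exp ((((((β - s) / β + u' l : ℝ) : ℂ)) * -(β : ℂ)) • dGamma (hubbardOneBody G t μ)) * creation (orb (f' l) 0) *
                          exp (-((((((β - s) / β + u' l : ℝ) : ℂ)) * -(β : ℂ)) • dGamma (hubbardOneBody G t μ)))) *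
                        (exp ((((((β - s) / β + u' l : ℝ) : ℂ)) * -(β : ℂ)) • dGamma (hubbardOneBody G t μ)) *
                            annihilation (orb (f' l) 0) *
                          exp (-((((((β - s) / β + u' l : ℝ) : ℂ)) * -(β : ℂ)) • dGamma (hubbardOneBody G t μ)))) -
                      ν 0 • (1 : Matrix (Finset (Orb Λ)) (Finset (Orb Λ)) ℂ)) *
                    ((exp ((((((β - s) / β + u' l : ℝ) : ℂ)) * -(β : ℂ)) • dGamma (hubbardOneBody G t μ)) * creation (orb (f' l) 1) *
                          exp (-((((((β - s) / β + u' l : ℝ) : ℂ)) * -(β : ℂ)) • dGamma (hubbardOneBody G t μ)))) *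
                        (exp ((((((β - s) / β + u' l : ℝ) : ℂ)) * -(β : ℂ)) • dGamma (hubbardOneBody G t μ)) *
                            annihilation (orb (f' l) 1) *
                          exp (-((((((β - s) / β + u' l : ℝ) : ℂ)) * -(β : ℂ)) • dGamma (hubbardOneBody G t μ)))) -
                      ν 1 • (1 : Matrix (Finset (Orb Λ)) (Finset (Orb Λ)) ℂ))).prod))).trace)
            (s / β)) ((β - s) / β))
      ((Matrix.gibbsWeight (β - s) (dGamma (hubbardOneBody G t μ) + (U : ℂ) • ∑ z : Λ,
          ((numberOp z 0 - ν 0 • 1) * (numberOp z 1 - ν 1 • 1))) * creation (orb x σ) *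
        (Matrix.gibbsWeight s (dGamma (hubbardOneBody G t μ) + (U : ℂ) • ∑ z : Λ,
          ((numberOp z 0 - ν 0 • 1) * (numberOp z 1 - ν 1 • 1))) * annihilation (orb y σ'))).trace) := by
  have hs := hasSum_dyson_trace_twoTime_shiftedQuartic hβ (hubbardOneBody G t μ) (creation (orb x σ)) (annihilation (orb y σ'))
    (fun _ : Λ => (1 : ℂ)) (fun z => orb z 0) (fun z => orb z 0) (fun z => orb z 1) (fun z => orb z 1)
    (fun _ => ν 0) (fun _ => ν 1) (U : ℂ) hs0 hsβ
  simp only [Finset.prod_const_one, one_mul, one_smul] at hs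
  simp only [numberOp]
  exact hs

/-- **The renormalised two-time perturbation series of the Hubbard two-point function (finite volume, operator level).**  For real
`β > 0`, `t, U, μ, ν` and `0 ≤ s ≤ β`, with the FREE one-body matrix at chemical potential `μ` and the INTERACTING model at `μ + Uν`:
the series of `hasSum_shiftedHubbard_twoPoint_twoTime_trace` at equal shifts `ν` sums to
`e^{−βUν²|Λ|} · Tr(e^{−(β−s)(H(t,U) − (μ+Uν)N)} c†_{xσ} e^{−s(H(t,U) − (μ+Uν)N)} c_{yσ′})` — the two-point Schwinger function at
imaginary-time separation `β − s`, expanded at fixed free Fermi surface with the counterterm `ν`. [cite: BenfattoGiulianiMastropietro2006, §2.1 (2.8)] -/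
theorem hasSum_hubbard_twoPoint_twoTime_renormalised_trace {β : ℝ} (hβ : 0 < β) (t U μ ν : ℝ) (x y : Λ) (σ σ' : Fin 2)
    {s : ℝ} (hs0 : 0 ≤ s) (hsβ : s ≤ β) :
    HasSum (fun N : ℕ => (U : ℂ) ^ N * ∑ kj ∈ antidiagonal N,
        orderedIntegral kj.1 (fun u : Fin kj.1 → ℝ =>
          orderedIntegral kj.2 (fun u' : Fin kj.2 → ℝ =>
            (-(β : ℂ)) ^ (kj.1 + kj.2) * ∑ f : Fin kj.1 → Λ, ∑ f' : Fin kj.2 → Λ,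
              (Matrix.gibbsWeight β (dGamma (hubbardOneBody G t μ)) * (annihilation (orb y σ') *
                ((List.ofFn fun i : Fin kj.1 =>
                    ((exp ((((u i : ℝ) : ℂ) * -(β : ℂ)) • dGamma (hubbardOneBody G t μ)) * creation (orb (f i) 0) *
                          exp (-((((u i : ℝ) : ℂ) * -(β : ℂ)) • dGamma (hubbardOneBody G t μ)))) *
                        (exp ((((u i : ℝ) : ℂ) * -(β : ℂ)) • dGamma (hubbardOneBody G t μ)) * annihilation (orb (f i) 0) *
                          exp (-((((u i : ℝ) : ℂ) * -(β : ℂ)) • dGamma (hubbardOneBody G t μ)))) -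
                      (ν : ℂ) • (1 : Matrix (Finset (Orb Λ)) (Finset (Orb Λ)) ℂ)) *
                    ((exp ((((u i : ℝ) : ℂ) * -(β : ℂ)) • dGamma (hubbardOneBody G t μ)) * creation (orb (f i) 1) *
                          exp (-((((u i : ℝ) : ℂ) * -(β : ℂ)) • dGamma (hubbardOneBody G t μ)))) *
                        (exp ((((u i : ℝ) : ℂ) * -(β : ℂ)) • dGamma (hubbardOneBody G t μ)) * annihilation (orb (f i) 1) *
                          exp (-((((u i : ℝ) : ℂ) * -(β : ℂ)) • dGamma (hubbardOneBody G t μ)))) -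
                      (ν : ℂ) • (1 : Matrix (Finset (Orb Λ)) (Finset (Orb Λ)) ℂ))).prod *
                  (exp (((((β - s) / β : ℝ) : ℂ) * -(β : ℂ)) • dGamma (hubbardOneBody G t μ)) * creation (orb x σ) *
                    exp (-(((((β - s) / β : ℝ) : ℂ) * -(β : ℂ)) • dGamma (hubbardOneBody G t μ)))) *
                  (List.ofFn fun l : Fin kj.2 =>
                    ((exp ((((((β - s) / β + u' l : ℝ) : ℂ)) * -(β : ℂ)) • dGamma (hubbardOneBody G t μ)) * creation (orb (f' l) 0) *
                          exp (-((((((β - s) / β + u' l : ℝ) : ℂ)) * -(β : ℂ)) • dGamma (hubbardOneBody G t μ)))) *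
                        (exp ((((((β - s) / β + u' l : ℝ) : ℂ)) * -(β : ℂ)) • dGamma (hubbardOneBody G t μ)) *
                            annihilation (orb (f' l) 0) *
                          exp (-((((((β - s) / β + u' l : ℝ) : ℂ)) * -(β : ℂ)) • dGamma (hubbardOneBody G t μ)))) -
                      (ν : ℂ) • (1 : Matrix (Finset (Orb Λ)) (Finset (Orb Λ)) ℂ)) *
                    ((exp ((((((β - s) / β + u' l : ℝ) : ℂ)) * -(β : ℂ)) • dGamma (hubbardOneBody G t μ)) * creation (orb (f' l) 1) *
                          exp (-((((((β - s) / β + u' l : ℝ) : ℂ)) * -(β : ℂ)) • dGamma (hubbardOneBody G t μ)))) *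
                        (exp ((((((β - s) / β + u' l : ℝ) : ℂ)) * -(β : ℂ)) • dGamma (hubbardOneBody G t μ)) *
                            annihilation (orb (f' l) 1) *
                          exp (-((((((β - s) / β + u' l : ℝ) : ℂ)) * -(β : ℂ)) • dGamma (hubbardOneBody G t μ)))) -
                      (ν : ℂ) • (1 : Matrix (Finset (Orb Λ)) (Finset (Orb Λ)) ℂ))).prod))).trace)
            (s / β)) ((β - s) / β))
      ((Real.exp (-(β * (U * ν ^ 2 * Fintype.card Λ))) : ℂ) *
        (Matrix.gibbsWeight (β - s) (hamiltonianWith G t U (μ + U * ν)) * creation (orb x σ) *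
          (Matrix.gibbsWeight s (hamiltonianWith G t U (μ + U * ν)) * annihilation (orb y σ'))).trace) := by
  have hs := hasSum_shiftedHubbard_twoPoint_twoTime_trace G hβ t U μ (fun _ => (ν : ℂ)) x y σ σ' hs0 hsβ
  beta_reduce at hs
  rw [dGamma_hubbardOneBody_add_smul_sum_shiftedVertex, gibbsWeight_add_smul_one, gibbsWeight_add_smul_one] at hs
  -- collect the two scalar factors `e^{−(β−s)c} · e^{−sc} = e^{−βc}`
  have hcollect : ∀ (A B Cm Dm : Matrix (Finset (Orb Λ)) (Finset (Orb Λ)) ℂ) (a b : ℂ),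
      (a • A * B * (b • Cm * Dm)).trace = (a * b) * (A * B * (Cm * Dm)).trace := by
    intro A B Cm Dm a b
    rw [Matrix.smul_mul, Matrix.smul_mul, Matrix.smul_mul, Matrix.mul_smul, smul_smul, Matrix.trace_smul, smul_eq_mul]
  rw [hcollect] at hs
  have hexp : Complex.exp (-((β - s : ℝ) : ℂ) * ((U * ν ^ 2 * Fintype.card Λ : ℝ) : ℂ)) *
      Complex.exp (-(s : ℂ) * ((U * ν ^ 2 * Fintype.card Λ : ℝ) : ℂ)) =
      ((Real.exp (-(β * (U * ν ^ 2 * Fintype.card Λ))) : ℝ) : ℂ) := by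
    rw [← Complex.exp_add, Complex.ofReal_exp]
    push_cast
    ring_nf
  rw [hexp] at hs
  exact hs

end ShiftedHubbard

end Literature.MathematicalPhysics.QuantumLattice

end
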